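import Summits.QuantumFields.YangMills.Theorems.UnitScaleTiltProp7QprimeCombL2Defs
import Summits.QuantumFields.YangMills.Theorems.UnitScaleTiltProp7CombBoxBlockDictionary
import Summits.QuantumFields.YangMills.Theorems.UnitScaleTiltProp7SectET3CombLettersT3
import Literature.MathematicalPhysics.QuantumFieldTheory.Balaban1983to89.B7Eq214FlatQprime
import HarnessLib

/-!
# Route `UnitScaleTilt`, crux K1 «MinimiserStabilityRegPr» (stmt-QuantumFields-19200) — ARCHITECTURE (A′)-comb, ★★OWNER RULINGS g29-№17∕№18 (A6ᶜ ∕ «HALF-BLOCK OFFSET»):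
# **`QprimeCombL2` AT THE FLAT MEMBER `W = 1`** — the print-literal comb site averaging behind the PROJECTOR SLOT OF RECORD `RcombL2` (displayed in S27ᴸ's N06 row `hN06`) is, at the flat
# background, the T³ ITERATED BLOCK MEAN of the gauge parameter TRANSLATED BY THE BASE POINT's LABELS (px6 g5's `ℤᵈ`-box ∕ T³-block dictionary read on `QprimeCombL2`'s own letters)

Cell `ym3-torus` ∕ width seat `ym-ust-19200-w1` (gen 14).  THEOREMS ONLY (0 `def`, 0 `sorry`); `--supports stmt-QuantumFields-19200 --as helper`, count-neutral.
YM₃ on T³ is a ladder rung (R3), not d = 4, not infinite volume, not the Clay problem; nothing here claims the stub, the crux, `hcoS`, COMB-FLAT-COERCIVITY, (I3′), [B9] Thm 3.11 or the gap.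

HONEST MODELLING NOTE OF RECORD (★★OWNER g29 RULING №18 (4), carried here as asked «w1 g14 for `RcombL2 1` vs `RS 1`»).  `QprimeCombL2 F n K c₀ W` reads the based pullback at
`x₀ = basePt F n K = embIter (K−n) 0` through lit's `QprimeIter (zdBlocking 3 L) (bgT L W♯) (K−n)`: its blocks are print's CORNER boxes `x̂_y + [0, Lᵏ)³` anchored at the `k`-centres (label
`c = (Lᵏ−1)∕2` per axis, lit `TorusGeometry.val_emb`), whereas the S letters (`QTwS`, `NS`, `RS`, `Qk`) live on the T³ blocks `[Lᵏy, Lᵏy + Lᵏ)³` CENTRED at `x̂_y`.  At the flat member the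
two partitions differ by the lattice translation `τ = t_{x₀}` by HALF A BLOCK: `QprimeCombL2 … 1 v w = siteAvgIter (K−n) ((toL2S⁻¹ v) ∘ t_{x₀}) w` (this file, ★★★), hence
`ker (QprimeCombL2 1) = {λ : siteAvgIter (K−n) (λ ∘ t_{x₀}) = 0}` while `N_S(1) = {λ : siteAvgIter (K−n) λ = const}` — so `RcombL2 1 = τ ∘ RS 1 ∘ τ⁻¹` MODULO the translation (and the
`Δ^η(1)`-invisible constants), NOT verbatim; and `RcombL2 1 = Rc 1` (px6's intrinsic comb projector: `N_c(1) = ker (QprimeCombL2 1) ⊕ constants` by ✓`QTw_one_gaugeDir_siteAvgIter'`).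
Member-level flat certificate of the displayed comb (COERC) row = COMB-FLAT-COERCIVITY := FILE B ∘ τ + isometry transfer (px6 ✓p695948, px13 τ-letters) + (I3′) δQ-SLICE — OPEN (A6ᶜ).

WHAT IS PROVED (ns `…Theorems.Prop7QprimeCombL2`; member `F`, `n ≤ K`, weight `c₀`):
* §1 `bgT_pull_bgUnits_one` (the comb transporters of the flat member's based pullback are all `1`; ✓`pull_const_one`, lit ✓`bgT_one`);
* §2 ★`QprimeIter_zdBlocking_one_eq_QpIter` — THE TREE'S TWO (3.19) LETTERS AGREE AT TRIVIAL TRANSPORTERS: `QprimeIter (zdBlocking d L) 1 j f z = QpIter L 1 f j z` (both the `j`-fold box mean;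
  lit `B7Eq78Linearization.QprimeIter` is `IsLandau138`'s letter, lit `B9Eq3114Proof.P12.QpIter` is `QTw`'s);
* §3 ★★★`QprimeCombL2_one_apply_eq_siteAvgIter` — `QprimeCombL2 F n K c₀ 1 v w = siteAvgIter (K−n) (x ↦ (toL2S⁻¹ v)(transl x (labels x₀))) w` (px6 g5 ✓`qpIter_one_transl_eq_siteAvgIter` by name);
  ★★`QprimeCombL2_one_eq_zero_iff_siteAvgIter` — `QprimeCombL2 … 1 v = 0 ↔ siteAvgIter (K−n) ((toL2S⁻¹ v) ∘ t_{x₀}) = 0`: the flat kernel in T³ letters;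
* §4 `eq_of_forall_shift_eq` (connectedness of the torus, any codomain), `siteAvgIter_const_mat`, `siteAvgIter_sub_mat`;
* §5 `DL2_one_toL2S_eq_smul_gaugeDir`, ★★`QDc_one_toL2S_eq_zero_iff` ∕ `…_iff_const` (`N_c(1)` = {translated block mean CONSTANT}), `covLapSite_one_toL2S_const`, `projR_eq_of_map_ker_eq`,
  ★★★`map_ker_QDc_one_eq_map_ker_QprimeCombL2_one`, ★★★`RcombL2_one_eq_Rc_one : RcombL2 F n K c₀ 1 = Rc F n K h c₀ cB 1`.
HONEST SCOPE.  Bookkeeping over px6 g5's dictionary and lit's flat letters; no estimate; `RcombL2 1 = τ RS 1 τ⁻¹` (the S projector) is NOT typed here (the (b1)∕(b2) pens', px13 g6 ∕ px6 g5);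
nothing of COMB-FLAT-COERCIVITY ∕ (I3′) ∕ N06 ∕ (A′) ∕ E′ ∕ EX ∕ the crux claimed.

References: T. Bałaban, CMP **99** (1985) 389–434 [Balaban1985BackgroundPropagators] ((3.17)–(3.19) p.393, (3.20)–(3.21) p.394); Commun. Math. Phys. **95** (1984) 17–40 [Balaban1984PropagatorsI]
((1.20) p.20); CMP **109** (1987) 249–301 [Balaban1987RG1] ((0.1) p.251); CMP **98** (1985) 17–51 [Balaban1985Averaging] ((78)–(80) p.30, (212) p.50).
-/

set_option autoImplicit false

noncomputable section

open scoped Matrix.Norms.L2Operator BigOperators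

namespace Summit.QuantumFields.YangMills.Theorems.Prop7QprimeCombL2

open Literature.MathematicalPhysics.QuantumFieldTheory.Balaban1983to89
open Literature.MathematicalPhysics.QuantumFieldTheory.Balaban1983to89.T3ContinuumYM3Torus
open Literature.MathematicalPhysics.QuantumLattice (blockSites)
open LatticeFieldCalculus (siteAvgIter)
open B7Prop1Explicit renaming Site → LSite
open B7Prop1Explicit (boxVec)
open B7Prop2Explicit (avgIter)
open B7Eq92Concrete (avgIter_one)
open B7Eq78Linearization (Qprime QprimeIter zdBlocking conjR conjR_apply QprimeIter_succ)
open B7Eq214FlatQprime (sum_blockSites_eq_sum_boxVec)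
open B8Eq119TwistedAxial (bgT bgT_one)
open B8Ineq130 (hol_one)
open B9Eq3114Proof.P12 (QpIter QpIter_zero QpIter_succ Qp)
open B10Eq27TorusAxialLog (transl pull pull_apply)
open T4TermwiseTorus (tlift)
open T3SectALandauChart (bgUnits bgUnits_one)
open B11Eq103H1Complex (SiteL2K)
open Summit.QuantumFields.YangMills.Theorems.Prop7SectET3Transport (periodsT3)
open Summit.QuantumFields.YangMills.Theorems.Prop7SectET3HilbertLetters (W₂ toL2S)
open Summit.QuantumFields.YangMills.Theorems.Prop7SPrint (basePt)
open Summit.QuantumFields.YangMills.Theorems.Prop7CombBoxBlockDictionary (qpIter_one_transl_eq_siteAvgIter QTw_one_gaugeDir_siteAvgIter' siteAvgIter_neg)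
open Summit.QuantumFields.YangMills.Theorems.Prop7CombChartFlatPureGauge (pull_const_one)
open Summit.QuantumFields.YangMills.Theorems.Prop7SectET3HilbertLetters (toL2 toL2B DL2 DstarL2 covLapSite)
open Summit.QuantumFields.YangMills.Theorems.Prop7SectET3CombLetters (QDc Rc QDc_apply QL2c_toL2 Rc_eq_projR)
open Summit.QuantumFields.YangMills.Theorems.Prop7SymAvgTw (QTw)
open Summit.QuantumFields.YangMills.Theorems.Prop7LandauDict (DL2_toL2S_eq_covDerivFwdT)
open T3SectALandauChart (covDerivFwdT eta eta_pos)
open T3LevelShift (siteShift siteShift_shift)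
open T3PrintedRegularOrbits (sites_eq)
open B11Eq103H1Complex (projR)

/-! ## §1 The flat member's based pullback and its comb transporters -/

section Flat

variable (F : T3Family) (n K : ℕ)

/-- All comb transporters of the flat member's based pullback are `1` (✓`Prop7HcoWOfGaugedRowsVacuous.pull_bgUnits_one` ∕ ✓`pull_const_one` class, lit ✓`bgT_one`).
[cite: Balaban1985Averaging, (19) p.21, (78)–(80) p.30] -/
theorem bgT_pull_bgUnits_one (x₀ : Site (F.P K) 0) :
    bgT (F.P K).L (pull (bgUnits F K (1 : GaugeField (F.P K) 0 (Matrix.specialUnitaryGroup (Fin 2) ℂ))) x₀) = fun _ _ _ => 1 := by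
  rw [bgUnits_one, pull_const_one, bgT_one]

end Flat

/-! ## §2 The tree's two (3.19) letters agree at trivial transporters -/

section Letters

variable {d : ℕ} {𝔸 : Type*} [NormedRing 𝔸] [NormedAlgebra ℂ 𝔸] [CompleteSpace 𝔸]

/-- ★ **`QprimeIter (zdBlocking d L) 1 j f = QpIter L 1 f j`**: lit's `B7Eq78Linearization.QprimeIter` on the `ℤᵈ` blocking (the letter of `IsLandau138` ∕ `QprimeCombL2`) and lit's
`B9Eq3114Proof.P12.QpIter` (the letter of `QTw`) coincide when every transporter is `1` — both are the `j`-fold box mean `Σ_{r ∈ [0,L)ᵈ} L⁻ᵈ·f(L·z + r)` iterated.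
[cite: Balaban1985BackgroundPropagators, (3.19) p.393; Balaban1985Averaging, (212) p.50] -/
theorem QprimeIter_zdBlocking_one_eq_QpIter (L : ℕ) (f : LSite d → 𝔸) :
    ∀ (j : ℕ) (z : LSite d), QprimeIter (zdBlocking d L) (fun _ _ _ => (1 : 𝔸ˣ)) j f z = QpIter L (1 : LSite d → Fin d → 𝔸ˣ) f j z
  | 0, z => rfl
  | j + 1, z => by
    rw [QprimeIter_succ, QpIter_succ, avgIter_one]
    show Qprime (blockSites L z) (fun _ => ((L : ℝ) ^ d)⁻¹) (fun _ => (1 : 𝔸ˣ)) (QprimeIter (zdBlocking d L) (fun _ _ _ => (1 : 𝔸ˣ)) j f) = _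
    unfold Qprime Qp
    rw [sum_blockSites_eq_sum_boxVec]
    refine Finset.sum_congr rfl fun r _ => ?_
    rw [hol_one, QprimeIter_zdBlocking_one_eq_QpIter L f j]

end Letters

/-! ## §3 `QprimeCombL2` at the flat member = the T³ iterated block mean of the translated parameter -/

section FlatMember

variable {F : T3Family} {n K : ℕ} {c₀ : ℝ}

/-- ★★★ **`QprimeCombL2 1` IS THE T³ ITERATED BLOCK MEAN OF THE PARAMETER TRANSLATED BY THE BASE POINT's LABELS**: for `n ≤ K`, `v` a gauge parameter and `w ∈ T^{(k)}`,
`QprimeCombL2 F n K c₀ 1 v w = siteAvgIter (K−n) (x ↦ (toL2S⁻¹ v)(transl x (labels x₀))) w`, `x₀ = basePt F n K` (half a block per axis — RULING №18's τ).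
[cite: Balaban1985BackgroundPropagators, (3.19) p.393; Balaban1984PropagatorsI, (1.20) p.20; Balaban1987RG1, (0.1) p.251] -/
theorem QprimeCombL2_one_apply_eq_siteAvgIter (hnK : n ≤ K) (v : SiteL2K ℂ 3 (periodsT3 F K) c₀ W₂) (w : Site (F.P K) (K - n)) :
    QprimeCombL2 F n K c₀ (1 : GaugeField (F.P K) 0 (Matrix.specialUnitaryGroup (Fin 2) ℂ)) v w
      = siteAvgIter (K - n) (fun x : Site (F.P K) 0 => (toL2S F K c₀).symm v (transl x (fun μ => (((basePt F n K μ).val : ℕ) : ℤ)))) w := by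
  have hk : K - n ≤ (F.P K).m + (F.P K).K := by show K - n ≤ F.m + K; omega
  rw [QprimeCombL2_apply, bgT_pull_bgUnits_one, QprimeIter_zdBlocking_one_eq_QpIter]
  exact qpIter_one_transl_eq_siteAvgIter (basePt F n K) (fun x => (toL2S F K c₀).symm v x) (K - n) hk w

/-- ★★ **THE FLAT KERNEL IN T³ LETTERS**: `QprimeCombL2 … 1 v = 0 ↔ siteAvgIter (K−n) ((toL2S⁻¹ v) ∘ t_{x₀}) = 0` — print's `N(Q′_k(1))` is the space of parameters whose TRANSLATED
iterated block means vanish (the S letter's `N_S(1)` has the untranslated means CONSTANT: RULING №18's «equal modulo τ, not verbatim»).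
[cite: Balaban1985BackgroundPropagators, (3.21) p.394; Balaban1984PropagatorsI, (1.20) p.20] -/
theorem QprimeCombL2_one_eq_zero_iff_siteAvgIter (hnK : n ≤ K) (v : SiteL2K ℂ 3 (periodsT3 F K) c₀ W₂) :
    QprimeCombL2 F n K c₀ (1 : GaugeField (F.P K) 0 (Matrix.specialUnitaryGroup (Fin 2) ℂ)) v = 0 ↔
      siteAvgIter (K - n) (fun x : Site (F.P K) 0 => (toL2S F K c₀).symm v (transl x (fun μ => (((basePt F n K μ).val : ℕ) : ℤ)))) = 0 := by
  constructor
  · intro h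
    funext w
    rw [← QprimeCombL2_one_apply_eq_siteAvgIter hnK, h]
  · intro h
    funext w
    rw [QprimeCombL2_one_apply_eq_siteAvgIter hnK, h]

end FlatMember

/-! ## §4 Connectedness of the coarse torus; block means of constants and differences -/

section Torus

variable {P : Params} {j : ℕ} {β : Type*}

/-- A function on the torus `T^{(j)}` invariant under every unit step is invariant under zeroing any set of coordinates. [folklore] -/
theorem apply_ite_zero_eq_of_forall_shift (f : Site P j → β) (hf : ∀ (y : Site P j) (μ : Fin P.d), f (y.shift μ) = f y)
    (s : Finset (Fin P.d)) (y : Site P j) : f (fun i => if i ∈ s then 0 else y i) = f y := by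
  classical
  -- one coordinate: iterate the unit step `(-(y μ)).val` times
  have hiter : ∀ (m : ℕ) (z : Site P j) (μ : Fin P.d), f (Function.update z μ (z μ + m)) = f z := by
    intro m
    induction m with
    | zero => intro z μ; rw [Nat.cast_zero, add_zero, Function.update_eq_self]
    | succ m ih =>
      intro z μ
      have hs : Function.update z μ (z μ + ((m + 1 : ℕ) : ZMod (P.sitesPerDir j))) = Site.shift (Function.update z μ (z μ + m)) μ := by
        funext i
        by_cases hi : i = μ
        · subst hi
          simp only [Site.shift, Function.update_self, Nat.cast_add, Nat.cast_one]
          ring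
        · simp only [Site.shift, Function.update_of_ne hi]
      rw [hs, hf, ih]
  have hzero : ∀ (z : Site P j) (μ : Fin P.d), f (Function.update z μ 0) = f z := by
    intro z μ
    have hm := hiter ((-(z μ)).val) z μ
    rwa [ZMod.natCast_zmod_val, add_neg_cancel] at hm
  induction s using Finset.induction_on generalizing y with
  | empty => simp
  | insert μ s hμ ih =>
    have hupd : (fun i => if i ∈ insert μ s then (0 : ZMod (P.sitesPerDir j)) else y i) = Function.update (fun i => if i ∈ s then 0 else y i) μ 0 := by
      funext i
      by_cases hi : i = μ
      · subst hi; simp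
      · simp [Finset.mem_insert, hi]
    rw [hupd, hzero, ih]

/-- **CONNECTEDNESS OF THE TORUS**: a function on `T^{(j)}` invariant under every unit step is constant. [cite: Balaban1984PropagatorsI, p.22 (text)] -/
theorem eq_of_forall_shift_eq (f : Site P j → β) (hf : ∀ (y : Site P j) (μ : Fin P.d), f (y.shift μ) = f y) (x y : Site P j) : f x = f y := by
  classical
  have hx := apply_ite_zero_eq_of_forall_shift f hf Finset.univ x
  have hy := apply_ite_zero_eq_of_forall_shift f hf Finset.univ y
  simp only [Finset.mem_univ, if_true] at hx hy
  rw [← hx, ← hy]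

end Torus

section BlockMeans

variable {F : T3Family} {K : ℕ}

/-- the iterated block mean of a constant is that constant. [cite: Balaban1984PropagatorsI, (1.20) p.20] -/
theorem siteAvgIter_const_mat (M : Matrix (Fin 2) (Fin 2) ℂ) : ∀ k : ℕ, siteAvgIter (P := F.P K) k (fun _ : Site (F.P K) 0 => M) = fun _ => M
  | 0 => rfl
  | k + 1 => by
    rw [B5Eq120IterProof.siteAvgIter_succ, siteAvgIter_const_mat M k]
    funext y
    unfold LatticeFieldCalculus.siteAvg
    rw [Finset.sum_const, Finset.card_univ, Fintype.card_fun, Fintype.card_fin, Fintype.card_fin, ← Nat.cast_smul_eq_nsmul ℝ, smul_smul,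
      Nat.cast_pow, inv_mul_cancel₀ (pow_ne_zero _ (by have := F.hL.2; exact_mod_cast (show (F.P K).L ≠ 0 by show F.L ≠ 0; omega))), one_smul]

/-- the iterated block mean of a difference. [cite: Balaban1984PropagatorsI, (1.20) p.20] -/
theorem siteAvgIter_sub_mat (k : ℕ) (f g : Site (F.P K) 0 → Matrix (Fin 2) (Fin 2) ℂ) :
    siteAvgIter k (fun x => f x - g x) = fun y => siteAvgIter k f y - siteAvgIter k g y := by
  have hmap := (B6SectAOntoV1.siteAvgIterLin (F.P K) (Matrix (Fin 2) (Fin 2) ℂ) k).map_sub f g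
  simp only [B6SectAOntoV1.siteAvgIterLin_apply] at hmap
  exact hmap

end BlockMeans

/-! ## §5 The flat kernels of the two comb projectors and `RcombL2 1 = Rc 1` -/

section Projectors

variable {F : T3Family} {n K : ℕ} (hnK : n ≤ K) {c₀ cB : ℝ} [Fact (0 < c₀)]

/-- **THE FLAT GAUGE DIRECTION IN brick L0a's LETTER**: `DL2 1 (toL2S λ) = toL2 ((−η⁻¹) • (b ↦ λ(b₋) − λ(b₊)))` (trivial transporters). [cite: Balaban1985BackgroundPropagators, (3.3) p.391] -/
theorem DL2_one_toL2S_eq_smul_gaugeDir (lam : Site (F.P K) 0 → Matrix (Fin 2) (Fin 2) ℂ) :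
    DL2 F n K c₀ (1 : GaugeField (F.P K) 0 (Matrix.specialUnitaryGroup (Fin 2) ℂ)) (toL2S F K c₀ lam)
      = toL2 F K c₀ ((((-(eta F n K)⁻¹ : ℝ) : ℂ)) • fun b : PBond (F.P K) 0 => lam b.src - lam b.tgt) := by
  refine (LinearEquiv.symm_apply_eq _).mp (funext fun b => ?_)
  rw [DL2_toL2S_eq_covDerivFwdT F n K c₀ 1 lam b, bgUnits_one]
  simp only [covDerivFwdT, Pi.smul_apply]
  rw [show conjR (1 : (Matrix (Fin 2) (Fin 2) ℂ)ˣ) (lam (b.src.shift b.dir)) = lam b.tgt by rw [conjR_apply]; simp [PBond.tgt],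
    RCLike.real_smul_eq_coe_smul (K := ℂ)]
  push_cast
  rw [neg_smul, ← smul_neg, neg_sub]
  rfl

/-- ★★ **THE FLAT KERNEL OF px6's INTRINSIC COMB PROJECTOR, IN T³ LETTERS**: `QDc 1 (toL2S λ) = 0 ↔` the translated iterated block mean `S_λ := siteAvgIter (K−n) (λ ∘ t_{x₀})` has zero coarse
gradient (`S_λ(ŷ c₊) = S_λ(ŷ c₋)` on every coarse bond; ✓`QTw_one_gaugeDir_siteAvgIter'`). [cite: Balaban1985BackgroundPropagators, (3.21) p.394, (3.115) p.418; Balaban1984PropagatorsI, (1.20) p.20] -/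
theorem QDc_one_toL2S_eq_zero_iff [Fact (0 < cB)] (lam : Site (F.P K) 0 → Matrix (Fin 2) (Fin 2) ℂ) :
    QDc F n K hnK c₀ cB (1 : GaugeField (F.P K) 0 (Matrix.specialUnitaryGroup (Fin 2) ℂ)) (toL2S F K c₀ lam) = 0 ↔
      ∀ c : PBond (F.P n) 0,
        siteAvgIter (K - n) (fun x : Site (F.P K) 0 => lam (transl x (fun μ => (((basePt F n K μ).val : ℕ) : ℤ)))) (siteShift (sites_eq F n K hnK) c.tgt)
          = siteAvgIter (K - n) (fun x : Site (F.P K) 0 => lam (transl x (fun μ => (((basePt F n K μ).val : ℕ) : ℤ)))) (siteShift (sites_eq F n K hnK) c.src) := by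
  have hη : (((-(eta F n K)⁻¹ : ℝ) : ℂ)) ≠ 0 := by
    have := eta_pos F n K
    exact_mod_cast (neg_ne_zero.mpr (inv_ne_zero this.ne'))
  rw [QDc_apply, DL2_one_toL2S_eq_smul_gaugeDir, QL2c_toL2, map_smul, map_smul, smul_eq_zero, LinearEquiv.map_eq_zero_iff,
    QTw_one_gaugeDir_siteAvgIter' F hnK lam]
  simp only [hη, false_or]
  rw [siteAvgIter_neg]
  constructor
  · intro h c
    have hc := congrFun h c
    simp only [Pi.zero_apply, sub_eq_zero, neg_inj] at hc
    exact hc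
  · intro h
    funext c
    simp only [Pi.zero_apply, sub_eq_zero, neg_inj]
    exact h c

/-- ★★ **HENCE `N_c(1)` = {parameters whose TRANSLATED iterated block mean is CONSTANT}** (the coarse torus is connected and `ŷ = siteShift` is a bijection commuting with the unit steps).
[cite: Balaban1985BackgroundPropagators, (3.21) p.394; Balaban1984PropagatorsI, (1.20) p.20, p.22] -/
theorem QDc_one_toL2S_eq_zero_iff_const [Fact (0 < cB)] (lam : Site (F.P K) 0 → Matrix (Fin 2) (Fin 2) ℂ) :
    QDc F n K hnK c₀ cB (1 : GaugeField (F.P K) 0 (Matrix.specialUnitaryGroup (Fin 2) ℂ)) (toL2S F K c₀ lam) = 0 ↔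
      ∃ M : Matrix (Fin 2) (Fin 2) ℂ, siteAvgIter (K - n) (fun x : Site (F.P K) 0 => lam (transl x (fun μ => (((basePt F n K μ).val : ℕ) : ℤ)))) = fun _ => M := by
  rw [QDc_one_toL2S_eq_zero_iff hnK]
  set S := siteAvgIter (K - n) (fun x : Site (F.P K) 0 => lam (transl x (fun μ => (((basePt F n K μ).val : ℕ) : ℤ)))) with hS
  constructor
  · intro h
    -- `S ∘ ŷ` is invariant under the unit steps of the coarse torus `T^{(0)}` of `F.P n`, hence constant; `ŷ` is onto
    have hstep : ∀ (y : Site (F.P n) 0) (μ : Fin (F.P n).d), (S ∘ siteShift (sites_eq F n K hnK)) (y.shift μ) = (S ∘ siteShift (sites_eq F n K hnK)) y :=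
      fun y μ => h ⟨y, μ⟩
    refine ⟨S (siteShift (sites_eq F n K hnK) default), funext fun w => ?_⟩
    obtain ⟨y, rfl⟩ := (siteShift (sites_eq F n K hnK)).surjective w
    exact eq_of_forall_shift_eq _ hstep y default
  · rintro ⟨M, hM⟩ c
    rw [hM]

/-- `Δ^η(1)` KILLS THE CONSTANTS: `covLapSite 1 (toL2S (x ↦ M)) = 0` (their flat gradient vanishes). [cite: Balaban1985BackgroundPropagators, (3.23) p.394] -/
theorem covLapSite_one_toL2S_const (M : Matrix (Fin 2) (Fin 2) ℂ) :
    covLapSite F n K c₀ (1 : GaugeField (F.P K) 0 (Matrix.specialUnitaryGroup (Fin 2) ℂ)) (toL2S F K c₀ (fun _ : Site (F.P K) 0 => M)) = 0 := by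
  show DstarL2 F n K c₀ 1 (DL2 F n K c₀ 1 (toL2S F K c₀ fun _ => M)) = 0
  rw [DL2_one_toL2S_eq_smul_gaugeDir]
  simp only [sub_self]
  rw [show ((fun _ : PBond (F.P K) 0 => (0 : Matrix (Fin 2) (Fin 2) ℂ))) = 0 from rfl, smul_zero, map_zero, map_zero]

/-- **`projR Δs Q′` DEPENDS ON `Q′` ONLY THROUGH `Δs·ker Q′`** (it is the orthogonal projection onto that subspace). [cite: Balaban1985BackgroundPropagators, (3.21) p.394] -/
theorem projR_eq_of_map_ker_eq {E : Type*} [NormedAddCommGroup E] [InnerProductSpace ℂ E] [FiniteDimensional ℂ E] {F₁ F₂ : Type*} [AddCommGroup F₁] [Module ℂ F₁]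
    [AddCommGroup F₂] [Module ℂ F₂] (Δs : E →ₗ[ℂ] E) (Q₁ : E →ₗ[ℂ] F₁) (Q₂ : E →ₗ[ℂ] F₂)
    (h : (LinearMap.ker Q₁).map Δs = (LinearMap.ker Q₂).map Δs) : projR Δs Q₁ = projR Δs Q₂ := by
  haveI : CompleteSpace ↥((LinearMap.ker Q₁).map Δs) := FiniteDimensional.complete ℂ _
  haveI : CompleteSpace ↥((LinearMap.ker Q₂).map Δs) := FiniteDimensional.complete ℂ _
  have key : ∀ (S₁ S₂ : Submodule ℂ E), S₁ = S₂ → ∀ [i₁ : S₁.HasOrthogonalProjection] [i₂ : S₂.HasOrthogonalProjection],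
      (@Submodule.starProjection ℂ E _ _ _ S₁ i₁ : E →L[ℂ] E) = @Submodule.starProjection ℂ E _ _ _ S₂ i₂ := by
    intro S₁ S₂ hS; subst hS; intro i₁ i₂; rfl
  change (((LinearMap.ker Q₁).map Δs).starProjection : E →L[ℂ] E).toLinearMap = (((LinearMap.ker Q₂).map Δs).starProjection : E →L[ℂ] E).toLinearMap
  rw [key _ _ h]

/-- ★★★ **`N_c(1) = ker (QprimeCombL2 1) + constants`, READ AFTER `Δ^η(1)`**: the two flat kernels have the same image under the covariant Laplacian — the translated block mean is
CONSTANT on `N_c(1)` and ZERO on `ker (QprimeCombL2 1)`, the difference being a constant parameter, which `Δ^η(1)` kills.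
[cite: Balaban1985BackgroundPropagators, (3.21) p.394, (3.23) p.394; Balaban1984PropagatorsI, (1.20) p.20] -/
theorem map_ker_QDc_one_eq_map_ker_QprimeCombL2_one [Fact (0 < cB)] :
    (LinearMap.ker (QDc F n K hnK c₀ cB (1 : GaugeField (F.P K) 0 (Matrix.specialUnitaryGroup (Fin 2) ℂ)))).map
        (covLapSite F n K c₀ (1 : GaugeField (F.P K) 0 (Matrix.specialUnitaryGroup (Fin 2) ℂ)))
      = (LinearMap.ker (QprimeCombL2 F n K c₀ (1 : GaugeField (F.P K) 0 (Matrix.specialUnitaryGroup (Fin 2) ℂ)))).map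
        (covLapSite F n K c₀ (1 : GaugeField (F.P K) 0 (Matrix.specialUnitaryGroup (Fin 2) ℂ))) := by
  apply le_antisymm
  · rintro w ⟨u, hu, rfl⟩
    rw [SetLike.mem_coe, LinearMap.mem_ker] at hu
    -- `u = toL2S λ`, its translated block mean is a constant `M`; subtract the constant parameter
    obtain ⟨lam, rfl⟩ : ∃ lam, toL2S F K c₀ lam = u := ⟨(toL2S F K c₀).symm u, LinearEquiv.apply_symm_apply _ _⟩
    obtain ⟨M, hM⟩ := (QDc_one_toL2S_eq_zero_iff_const hnK lam).1 hu
    refine ⟨toL2S F K c₀ (fun x => lam x - M), ?_, ?_⟩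
    · rw [SetLike.mem_coe, LinearMap.mem_ker, QprimeCombL2_one_eq_zero_iff_siteAvgIter hnK]
      simp only [LinearEquiv.symm_apply_apply]
      rw [siteAvgIter_sub_mat, hM, siteAvgIter_const_mat]
      funext y
      exact sub_self M
    · have hsplit : toL2S F K c₀ (fun x => lam x - M) = toL2S F K c₀ lam - toL2S F K c₀ (fun _ => M) := by
        rw [← map_sub]; rfl
      rw [hsplit, map_sub, covLapSite_one_toL2S_const, sub_zero]
  · refine Submodule.map_mono fun u hu => ?_
    rw [LinearMap.mem_ker] at hu ⊢
    obtain ⟨lam, rfl⟩ : ∃ lam, toL2S F K c₀ lam = u := ⟨(toL2S F K c₀).symm u, LinearEquiv.apply_symm_apply _ _⟩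
    rw [QprimeCombL2_one_eq_zero_iff_siteAvgIter hnK] at hu
    simp only [LinearEquiv.symm_apply_apply] at hu
    rw [QDc_one_toL2S_eq_zero_iff hnK]
    intro c
    rw [hu]
    rfl

/-- ★★★ **`RcombL2 1 = Rc 1` — THE PROJECTOR SLOT OF RECORD AND px6 g5's INTRINSIC COMB PROJECTOR COINCIDE AT THE FLAT MEMBER** (both are `projR (Δ^η(1)) ·` and their `Δ^η(1)`-images of
kernels agree), so a flat certificate (A6ᶜ ∕ COMB-FLAT-COERCIVITY) typed at `laplaceAc … 1` (projector `Rc 1`) reads at the DISPLAYED slot `laplaceAK … (RcombL2 … 1) …` of S27ᴸ's `hN06` by `rw`.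
The S projector `RS 1` is NOT equal to either: ★★OWNER RULING №18 — equal only after conjugation by the half-block translation `τ = t_{x₀}`.
[cite: Balaban1985BackgroundPropagators, (3.20)-(3.21) p.394; Balaban1984PropagatorsI, (1.20) p.20] -/
theorem RcombL2_one_eq_Rc_one [Fact (0 < cB)] :
    RcombL2 F n K c₀ (1 : GaugeField (F.P K) 0 (Matrix.specialUnitaryGroup (Fin 2) ℂ))
      = Rc F n K hnK c₀ cB (1 : GaugeField (F.P K) 0 (Matrix.specialUnitaryGroup (Fin 2) ℂ)) := by
  rw [RcombL2_eq_projR, Rc_eq_projR]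
  exact projR_eq_of_map_ker_eq _ _ _ (map_ker_QDc_one_eq_map_ker_QprimeCombL2_one hnK).symm

end Projectors

end Summit.QuantumFields.YangMills.Theorems.Prop7QprimeCombL2

end
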